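import Summits.RiemannHypothesis.RiemannHypothesis.Theorems.PfPersistenceRatioIsolation
import HarnessLib

/-!
# PF persistence — the ratio binders REDUCED: the pattern cap is the in-tree form bound `|vᵀΘ_q v| ≤ vᵀv`, so
dial isolation in the `∀`-window gauge-ratio class needs only a LOW PLANE of `ζ` and ONE LOW VECTOR with a pattern
floor (pub-rhpf barrier-prover gen 5, file 3; CASE-DAG leaf G1.21b / §6 PINCER `(Z)`-cell)

**HONEST FRAMING. This is a long-odds MECHANISM / RIGIDITY campaign; no RH claims.** RH-free linear algebra and
dial-space bookkeeping; `ζ`'s Weil positivity is never assumed or concluded. The reduced binders are HYPOTHESES.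

## What is proved

Files 1–2 (`PfPersistenceRatioRejection` 1e789d75d549, `PfPersistenceRatioIsolation` 9040a7eb0ec6) reject dials
from three per-window binders: a low plane of `ζ` (height `η₂`), a CAP `C` of the `q`-pattern on that plane, and a
low vector with a pattern FLOOR `ρ`. The cap is not a binder: by the cell's guarded form bound
`primePattern_form_abs_le` (`|vᵀΘ_q v| ≤ vᵀv` at every genuine window reaching `q`, fake-4 / GalerkinDownCone,
RH-free and window-uniform) one may always take `C = 1`. Hence:

* §1 `dial_not_mem_gaugeRatioAt_light` / `…_neg_light` — ONE WINDOW: a plane of `ζ`-height `≤ η₂` (`η₂ ≥ 0`) and a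
  vector `v₀` of `ζ`-height `≤ η` with pattern value `≥ ρ` (resp. `≤ −ρ`) reject every up- (resp. down-) dial
  amplitude `|t|` with `τη₂ + η(1 − τ) < |t|·(ρ(1 − τ) − τ)`.
* §2 `ClusterBindersLight q W ρ` / `ClusterBindersNegLight q W ρ` — the REDUCED packages along a window sequence
  (every `W n` reaches `q`; for every `δ > 0` some `W n` carries a `δ`-low plane of `ζ` and a `δ`-low vector with
  pattern value `≥ ρ`, resp. `≤ −ρ`), and `ClusterBindersLight.toClusterBinders : … → ClusterBinders q W ρ 1`
  (resp. `…Neg…`).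
* §2 `upDial_not_mem_gaugeRatioClass_light`, `downDial_not_mem_gaugeRatioClass_light`,
  `dial_mem_gaugeRatioClass_imp_trivial_light` — DIAL ISOLATION from the reduced binders for every ratio
  `0 ≤ τ < 1` with `τ(1 + ρ) < ρ` (i.e. `τ < ρ/(1 + ρ)`; since `ρ ≤ 1` by the same form bound this covers `τ < 1/2`
  at best — for larger `τ` the true compression cap of files 1–2 is needed).

What remains TYPED for the `(Z)`-cell's dial door is therefore exactly: (B2) `ζ` has planes of arbitrarily small
height along the far windows (its even 2-cluster; DATA PF-N2), and (Bρ) some arbitrarily low vector keeps pattern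
value `≥ ρ > 0` (resp. `≤ −ρ`) at lag `log q` (DATA PF-C7 / the `DialReady`-type pattern margin); nothing else.

References: the cell files cited by name; R. Courant, D. Hilbert, Methods of Mathematical Physics I, §I.4.
-/

set_option linter.dupNamespace false

noncomputable section

open Real Set Matrix

namespace Summit.RiemannHypothesis.RiemannHypothesis.Theorems.PfPersistence

/-! ## §1 One window: the cap is free -/

/-- PROVED (the cap is free): on any vectors, `−vᵀΘ_q v ≤ 1 · vᵀv` and `vᵀΘ_q v ≤ 1 · vᵀv` at a genuine window
reaching `q` (`primePattern_form_abs_le`). [folklore] -/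
theorem primePattern_form_neg_le {q : ℕ} {win : Window} (hq : q ∈ primeRange (2 * win.a))
    (v : Fin (win.N + 1) → ℝ) : -(v ⬝ᵥ (primePattern q win *ᵥ v)) ≤ 1 * (v ⬝ᵥ v) := by
  have := primePattern_form_abs_le win.ha hq v
  rw [abs_le] at this
  linarith [this.1]

/-- PROVED (the cap is free, other sign). [folklore] -/
theorem primePattern_form_le {q : ℕ} {win : Window} (hq : q ∈ primeRange (2 * win.a))
    (v : Fin (win.N + 1) → ℝ) : v ⬝ᵥ (primePattern q win *ᵥ v) ≤ 1 * (v ⬝ᵥ v) := by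
  have := primePattern_form_abs_le win.ha hq v
  rw [abs_le] at this
  linarith [this.2]

/-- **PROVED — UP-DIAL REJECTION FROM THE REDUCED BINDERS (one window).** A plane `{x, y}` (nonzero, orthogonal)
of `ζ`-height `≤ η₂`, `η₂ ≥ 0`, and a vector `v₀ ≠ 0` of `ζ`-height `≤ η` with pattern value `≥ ρ·v₀ᵀv₀`: every
dial with `t = 2(K − 1)w(q) > 0` and `τη₂ + η(1 − τ) < t·(ρ(1 − τ) − τ)` (`0 ≤ τ < 1`) is NOT in the gauge-ratio
conjunct at the window. [folklore] -/
theorem dial_not_mem_gaugeRatioAt_light {q : ℕ} {win : Window} (hq : q ∈ primeRange (2 * win.a))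
    {x y : Fin (win.N + 1) → ℝ} (hx : x ≠ 0) (hy : y ≠ 0) (hxy : y ⬝ᵥ x = 0) {η₂ : ℝ} (hη₂ : 0 ≤ η₂)
    (hZ : ∀ α β : ℝ, (α • x + β • y) ⬝ᵥ (zetaDatum win *ᵥ (α • x + β • y))
      ≤ η₂ * ((α • x + β • y) ⬝ᵥ (α • x + β • y)))
    {v₀ : Fin (win.N + 1) → ℝ} (hv₀ : v₀ ≠ 0) {η ρ : ℝ}
    (hZv : v₀ ⬝ᵥ (zetaDatum win *ᵥ v₀) ≤ η * (v₀ ⬝ᵥ v₀))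
    (hρ : ρ * (v₀ ⬝ᵥ v₀) ≤ v₀ ⬝ᵥ (primePattern q win *ᵥ v₀))
    {τ : ℝ} (hτ0 : 0 ≤ τ) (hτ : τ < 1) {K : ℝ} (ht : 0 < 2 * (K - 1) * zetaWeights q)
    (hamp : τ * η₂ + η * (1 - τ) < 2 * (K - 1) * zetaWeights q * (ρ * (1 - τ) - τ)) :
    datumOf (dial q K zetaWeights) ∉ gaugeRatioAt τ win :=
  dial_not_mem_gaugeRatioAt_of_amplitude hq hx hy hxy hη₂ zero_le_one hZ
    (fun α β => primePattern_form_neg_le hq _) hv₀ hZv hρ hτ0 hτ ht (by simpa using hamp)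

/-- **PROVED — DOWN-DIAL REJECTION FROM THE REDUCED BINDERS (one window):** pattern value `≤ −ρ·v₀ᵀv₀` on the
low vector; every `t = 2(K − 1)w(q) < 0` with `τη₂ + η(1 − τ) < (−t)·(ρ(1 − τ) − τ)` is rejected. [folklore] -/
theorem dial_not_mem_gaugeRatioAt_neg_light {q : ℕ} {win : Window} (hq : q ∈ primeRange (2 * win.a))
    {x y : Fin (win.N + 1) → ℝ} (hx : x ≠ 0) (hy : y ≠ 0) (hxy : y ⬝ᵥ x = 0) {η₂ : ℝ} (hη₂ : 0 ≤ η₂)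
    (hZ : ∀ α β : ℝ, (α • x + β • y) ⬝ᵥ (zetaDatum win *ᵥ (α • x + β • y))
      ≤ η₂ * ((α • x + β • y) ⬝ᵥ (α • x + β • y)))
    {v₀ : Fin (win.N + 1) → ℝ} (hv₀ : v₀ ≠ 0) {η ρ : ℝ}
    (hZv : v₀ ⬝ᵥ (zetaDatum win *ᵥ v₀) ≤ η * (v₀ ⬝ᵥ v₀))
    (hρ : v₀ ⬝ᵥ (primePattern q win *ᵥ v₀) ≤ -ρ * (v₀ ⬝ᵥ v₀))
    {τ : ℝ} (hτ0 : 0 ≤ τ) (hτ : τ < 1) {K : ℝ} (ht : 2 * (K - 1) * zetaWeights q < 0)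
    (hamp : τ * η₂ + η * (1 - τ) < -(2 * (K - 1) * zetaWeights q) * (ρ * (1 - τ) - τ)) :
    datumOf (dial q K zetaWeights) ∉ gaugeRatioAt τ win :=
  dial_not_mem_gaugeRatioAt_of_amplitude_neg hq hx hy hxy hη₂ zero_le_one hZ
    (fun α β => primePattern_form_le hq _) hv₀ hZv hρ hτ0 hτ ht (by simpa using hamp)

/-! ## §2 The reduced packages along a window sequence; isolation for `τ < ρ/(1 + ρ)` -/

/-- the REDUCED UP-DIAL BINDERS along `W : ℕ → Window` at `q` with pattern floor `ρ` (TYPED hypothesis package):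
every `W n` reaches `q`; for every `δ > 0` some `W n` carries a plane `{x, y}` of `ζ`-height `≤ δ` and a vector
`v₀ ≠ 0` of `ζ`-height `≤ δ` with pattern value `≥ ρ`. (B2 + Bρ of the docstring; no cap.) [folklore] -/
structure ClusterBindersLight (q : ℕ) (W : ℕ → Window) (ρ : ℝ) : Prop where
  reaches : ∀ n, q ∈ primeRange (2 * (W n).a)
  small : ∀ δ : ℝ, 0 < δ → ∃ (n : ℕ) (x y v₀ : Fin ((W n).N + 1) → ℝ), x ≠ 0 ∧ y ≠ 0 ∧ y ⬝ᵥ x = 0 ∧ v₀ ≠ 0 ∧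
    (∀ α β : ℝ, (α • x + β • y) ⬝ᵥ (zetaDatum (W n) *ᵥ (α • x + β • y))
      ≤ δ * ((α • x + β • y) ⬝ᵥ (α • x + β • y))) ∧
    v₀ ⬝ᵥ (zetaDatum (W n) *ᵥ v₀) ≤ δ * (v₀ ⬝ᵥ v₀) ∧
    ρ * (v₀ ⬝ᵥ v₀) ≤ v₀ ⬝ᵥ (primePattern q (W n) *ᵥ v₀)

/-- the REDUCED DOWN-DIAL BINDERS (pattern value `≤ −ρ` on the low vector). [folklore] -/
structure ClusterBindersNegLight (q : ℕ) (W : ℕ → Window) (ρ : ℝ) : Prop where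
  reaches : ∀ n, q ∈ primeRange (2 * (W n).a)
  small : ∀ δ : ℝ, 0 < δ → ∃ (n : ℕ) (x y v₀ : Fin ((W n).N + 1) → ℝ), x ≠ 0 ∧ y ≠ 0 ∧ y ⬝ᵥ x = 0 ∧ v₀ ≠ 0 ∧
    (∀ α β : ℝ, (α • x + β • y) ⬝ᵥ (zetaDatum (W n) *ᵥ (α • x + β • y))
      ≤ δ * ((α • x + β • y) ⬝ᵥ (α • x + β • y))) ∧
    v₀ ⬝ᵥ (zetaDatum (W n) *ᵥ v₀) ≤ δ * (v₀ ⬝ᵥ v₀) ∧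
    v₀ ⬝ᵥ (primePattern q (W n) *ᵥ v₀) ≤ -ρ * (v₀ ⬝ᵥ v₀)

/-- **PROVED — THE CAP IS FREE:** the reduced package is the full package with `C = 1`. [folklore] -/
theorem ClusterBindersLight.toClusterBinders {q : ℕ} {W : ℕ → Window} {ρ : ℝ} (h : ClusterBindersLight q W ρ) :
    ClusterBinders q W ρ 1 where
  reaches := h.reaches
  cap_nonneg := zero_le_one
  small := fun δ hδ => by
    obtain ⟨n, x, y, v₀, hx, hy, hxy, hv₀, hZ, hZv, hρ⟩ := h.small δ hδ
    exact ⟨n, x, y, v₀, hx, hy, hxy, hv₀, hZ, fun α β => primePattern_form_neg_le (h.reaches n) _, hZv, hρ⟩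

/-- **PROVED — THE CAP IS FREE (down-dials).** [folklore] -/
theorem ClusterBindersNegLight.toClusterBindersNeg {q : ℕ} {W : ℕ → Window} {ρ : ℝ}
    (h : ClusterBindersNegLight q W ρ) : ClusterBindersNeg q W ρ 1 where
  reaches := h.reaches
  cap_nonneg := zero_le_one
  small := fun δ hδ => by
    obtain ⟨n, x, y, v₀, hx, hy, hxy, hv₀, hZ, hZv, hρ⟩ := h.small δ hδ
    exact ⟨n, x, y, v₀, hx, hy, hxy, hv₀, hZ, fun α β => primePattern_form_le (h.reaches n) _, hZv, hρ⟩

/-- **PROVED — DIAL ISOLATION FROM THE REDUCED BINDERS (up-dials):** under `ClusterBindersLight q W ρ`, for every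
`0 ≤ τ < 1` with `τ(1 + ρ) < ρ`, NO up-dial of `ζ` at `q` of any amplitude `t = 2(K − 1)w(q) > 0` lies in
`GaugeRatioClass τ`. [folklore] -/
theorem upDial_not_mem_gaugeRatioClass_light {q : ℕ} {W : ℕ → Window} {ρ : ℝ} (hB : ClusterBindersLight q W ρ)
    {τ : ℝ} (hτ0 : 0 ≤ τ) (hτ : τ < 1) (hτρ : τ * (1 + ρ) < ρ) {K : ℝ} (ht : 0 < 2 * (K - 1) * zetaWeights q) :
    datumOf (dial q K zetaWeights) ∉ GaugeRatioClass τ :=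
  upDial_not_mem_gaugeRatioClass hB.toClusterBinders hτ0 hτ (by linarith) ht

/-- **PROVED — DIAL ISOLATION FROM THE REDUCED BINDERS (down-dials).** [folklore] -/
theorem downDial_not_mem_gaugeRatioClass_light {q : ℕ} {W : ℕ → Window} {ρ : ℝ}
    (hB : ClusterBindersNegLight q W ρ) {τ : ℝ} (hτ0 : 0 ≤ τ) (hτ : τ < 1) (hτρ : τ * (1 + ρ) < ρ) {K : ℝ}
    (ht : 2 * (K - 1) * zetaWeights q < 0) : datumOf (dial q K zetaWeights) ∉ GaugeRatioClass τ :=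
  downDial_not_mem_gaugeRatioClass hB.toClusterBindersNeg hτ0 hτ (by linarith) ht

/-- **PROVED — BOTH SIGNS, REDUCED BINDERS: the only `q`-dial of `ζ` that can lie in `GaugeRatioClass τ`
(`0 ≤ τ < 1`, `τ(1 + ρ) < ρ`, `τ(1 + ρ′) < ρ′`) is the trivial one,** `(K − 1)w(q) = 0`. What the `(Z)`-cell's
dial door needs beyond the kernel is exactly (B2) low planes of `ζ` along far windows and (Bρ) a pattern floor
on a low vector — per-window DATA, not claimed. [folklore] -/
theorem dial_mem_gaugeRatioClass_imp_trivial_light {q : ℕ} {W : ℕ → Window} {ρ ρ' : ℝ}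
    (hB : ClusterBindersLight q W ρ) (hB' : ClusterBindersNegLight q W ρ') {τ : ℝ} (hτ0 : 0 ≤ τ) (hτ : τ < 1)
    (hτρ : τ * (1 + ρ) < ρ) (hτρ' : τ * (1 + ρ') < ρ') {K : ℝ}
    (hmem : datumOf (dial q K zetaWeights) ∈ GaugeRatioClass τ) : (K - 1) * zetaWeights q = 0 := by
  by_contra h
  rcases lt_or_gt_of_ne h with hlt | hgt
  · exact downDial_not_mem_gaugeRatioClass_light hB' hτ0 hτ hτρ' (K := K) (by linarith) hmem
  · exact upDial_not_mem_gaugeRatioClass_light hB hτ0 hτ hτρ (K := K) (by linarith) hmem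

/-- PROVED (range of the reduced statement): a pattern floor is at most `1` (`ρ·v₀ᵀv₀ ≤ v₀ᵀΘ_q v₀ ≤ v₀ᵀv₀`), so
`τ(1 + ρ) < ρ` forces `τ < 1/2`; ratios `τ ∈ [1/2, 1)` need the true compression cap of files 1–2. [folklore] -/
theorem patternFloor_le_one {q : ℕ} {win : Window} (hq : q ∈ primeRange (2 * win.a)) {v₀ : Fin (win.N + 1) → ℝ}
    (hv₀ : v₀ ≠ 0) {ρ : ℝ} (hρ : ρ * (v₀ ⬝ᵥ v₀) ≤ v₀ ⬝ᵥ (primePattern q win *ᵥ v₀)) : ρ ≤ 1 := by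
  have h1 := primePattern_form_le hq v₀
  have hvv : 0 < v₀ ⬝ᵥ v₀ := dotProduct_self_pos_of_ne_zero hv₀
  nlinarith

end Summit.RiemannHypothesis.RiemannHypothesis.Theorems.PfPersistence

end
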